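import Mathlib
import Summits.NavierStokesRegularity.NavierStokesRegularity.Theorems.TaoLadderRungTwoFlatTruncatedHopLanding
import Summits.NavierStokesRegularity.NavierStokesRegularity.Theorems.TaoLadderRungTwoFlatLinearisedPersistence
import HarnessLib

/-!
# From the template's PHASE to the rule's SECTION TIME: the landing of `anchored_landing` read at `τ₁ := τ − h`
  (helper for the K_A♭ parent item stmt-NavierStokesRegularity-22987 `FlatGapCertificatesV2`, children 1A/2A of route
  TaoLadderRungTwoFlat; cell harvest/h2-tao-ladder, p1 g22; the missing link between `MirrorPulse.anchored_landing` (L5a)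
  and `HopTube.coreClause_recentre` (LADDER §50.8, §51; `TubeStepCore`)

`MirrorPulse.anchored_landing` lands the hop flow `X` at the certificate time `τ` next to the pulse-family member
`κ·Φ(·, τ + h)` — the right amplitude `κ`, but at PHASE `h` (`|h| ≤ 2C_aB`). The frame's core clause compares the
re-centred state with the PHASE-`0` section state (`u⋆ ∝ Φ(·, 0) = Φ(·+1, τ)`). The canonical rule is free to choose
its section time: at `τ₁ := τ − h` the flow sits next to `κ·Φ(·, τ)` up to SECOND-ORDER terms, because
`X(τ−h) − κΦ(τ) = [X(τ−h) − X(τ) + hẊ(τ)] + [X(τ) − κΦ(τ+h)] + κ[Φ(τ+h) − Φ(τ) − hΦ̇(τ)] + h[κΦ̇(τ) − Ẋ(τ)]`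
and, writing `X(τ) = κΦ(τ+h) + d`, `κΦ̇(τ) − Ẋ(τ) = κ[Q(Φ)(τ) − Q(Φ)(τ+h)] + κ(1−κ)Q(Φ)(τ+h) − Lin_{κΦ(τ+h)}(d) − Q(d)`:
every piece is `O(h²)`, `O(h·|κ−1|)`, `O(h·D)` or `O(h·D²)` in the head gauge `g^{k⁺}` (the tree's gauge Taylor bound
`QuadPolar.gauge_abs_taylor_le`, the acceleration bound `gauge_abs_accel_le`, and the mixed bounds
`gauge_abs_linTermOn_le_of_sup` / `gauge_abs_quadTermOn_le`).

* `quadTermOn_timeShift`, `gauge_abs_quadTermOn_sub_time_le` — bookkeeping: `Q` of a time-shifted family; time-Lipschitz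
  of `Q(Φ)` in the head gauge (`≤ 2‖T♭‖₁²g²M_w³·|h|`);
* `landing_at_section_time` — **for global solutions `X`, `Φ` of `T♭(ε)` with head-gauge bounds `M_X`, `M_w` near `τ`,
  `|Φ| ≤ M`, `|h| ≤ 1`, and `g^{m⁺}|X_m(τ) − κΦ_m(τ+h)| ≤ D` on the shells `m ≥ e` (edge shell included): on every shell
  `m ≥ e + 1`, `g^{m⁺}|X_m(τ−h) − κΦ_m(τ)| ≤ D + 2‖T♭‖₁²g²(M_X³ + 2|κ|M_w³)h² + |h|·(|κ||1−κ|‖T♭‖₁gM_w² + 2‖T♭‖₁|κ|MgD +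
  ‖T♭‖₁gD²)`** — with `|h| ≤ 2C_aB`, `|κ−1| ≤ C_aB`, `D = O(B)` this is `D + O(B²)`: the phase is paid at second order, as
  the frame's `coreClause_recentre` (phase-`0` reference) requires.

HONEST FRAMING: elementary perturbation bookkeeping about MODEL-lattice solutions (Tao 2016 §4 vocabulary on `S♭`);
all bounds are HYPOTHESES; nothing certified; nothing about the Navier–Stokes equations.
-/

noncomputable section

-- the sub-problem namespace repeats the summit name by design (D-0017)
set_option linter.dupNamespace false

namespace Summit.NavierStokesRegularity.NavierStokesRegularity.Theorems

open Set Filter Literature.Analysis.FluidPDE Literature.Analysis.FluidPDE.TaoCascade QuadPolar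
open scoped Topology

namespace MirrorPulse

/-- `Q` of a time-shifted family is the time-shifted `Q`. [cite: Tao2016AveragedNS, §4 (4.8); route TaoLadderRungTwoFlat, phase bookkeeping] -/
theorem quadTermOn_timeShift (ε : ℝ) (Φ : Fin 2 → ℤ → ℝ → ℝ) (h : ℝ) (i : Fin 2) (n : ℤ) (t : ℝ) :
    quadTermOn shiftSetFlat 0 (mirrorTable ε ε) (fun j k s => Φ j k (s + h)) i n t
      = quadTermOn shiftSetFlat 0 (mirrorTable ε ε) Φ i n (t + h) := by
  simp only [quadTermOn]

/-- **Time-Lipschitz of `Q(Φ)` in the head gauge**: for a global solution `Φ` with `g^{k⁺}|Φ| ≤ M_w` on `[τ−1, τ+1]`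
and `|h| ≤ 1`: `g^{n⁺}|Q(Φ)_n(τ+h) − Q(Φ)_n(τ)| ≤ 2‖T♭‖₁²g²M_w³·|h|` (mean value with `gauge_abs_accel_le`).
[cite: Tao2016AveragedNS, §4 (4.8); route TaoLadderRungTwoFlat, phase bookkeeping (cf. `QuadPolar.gauge_abs_taylor_le`)] -/
theorem gauge_abs_quadTermOn_sub_time_le {ε : ℝ} {Φ : Fin 2 → ℤ → ℝ → ℝ} {g Mw τ h : ℝ} (hΦ : IsGlobalSol ε Φ)
    (hg : 1 ≤ g) (hMw : 0 ≤ Mw) (hΦg : ∀ j k, ∀ t ∈ Icc (τ - 1) (τ + 1), headGauge g j k * |Φ j k t| ≤ Mw)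
    (hh : |h| ≤ 1) (i : Fin 2) (n : ℤ) :
    headGauge g i n * |quadTermOn shiftSetFlat 0 (mirrorTable ε ε) Φ i n (τ + h)
        - quadTermOn shiftSetFlat 0 (mirrorTable ε ε) Φ i n τ|
      ≤ 2 * (tableAbsSum shiftSetFlat (mirrorTable ε ε)) ^ 2 * g ^ 2 * Mw ^ 3 * |h| := by
  have hwpos : ∀ j k, 0 < headGauge g j k := fun j k => headGauge_pos (by linarith) j k
  have hA : IsWindowAdmissible (headGauge g) g := isWindowAdmissible_headGauge hg
  have hw0 : 0 < headGauge g i n := hwpos i n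
  have hQd : ∀ s, HasDerivAt (fun s => quadTermOn shiftSetFlat 0 (mirrorTable ε ε) Φ i n s)
      (linTermOn shiftSetFlat 0 (mirrorTable ε ε) Φ
        (fun j k s => quadTermOn shiftSetFlat 0 (mirrorTable ε ε) Φ j k s) i n s) s := fun s =>
    MirrorPulse.hasDerivAt_quadTermOn shiftSetFlat 0 (mirrorTable ε ε) (fun j k => hΦ j k s) i n
  have hsub : uIcc τ (τ + h) ⊆ Icc (τ - 1) (τ + 1) := by
    intro x hx
    have h1 := (abs_le.mp hh).1
    have h2 := (abs_le.mp hh).2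
    rcases le_or_gt τ (τ + h) with hτs | hτs
    · rw [uIcc_of_le hτs] at hx; exact ⟨by linarith [hx.1], by linarith [hx.2]⟩
    · rw [uIcc_of_ge hτs.le] at hx; exact ⟨by linarith [hx.1], by linarith [hx.2]⟩
  have hb : ∀ x ∈ uIcc τ (τ + h), ‖headGauge g i n * linTermOn shiftSetFlat 0 (mirrorTable ε ε) Φ
        (fun j k s => quadTermOn shiftSetFlat 0 (mirrorTable ε ε) Φ j k s) i n x‖
      ≤ 2 * (tableAbsSum shiftSetFlat (mirrorTable ε ε)) ^ 2 * g ^ 2 * Mw ^ 3 := by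
    intro x hx
    rw [Real.norm_eq_abs, abs_mul, abs_of_pos hw0]
    exact gauge_abs_accel_le isNearestNeighbourSet_shiftSetFlat (mirrorTable ε ε) hwpos hA hMw
      (fun j k => hΦg j k x (hsub hx)) i n
  have hd : ∀ x ∈ uIcc τ (τ + h), HasDerivWithinAt
      (fun s => headGauge g i n * quadTermOn shiftSetFlat 0 (mirrorTable ε ε) Φ i n s)
      (headGauge g i n * linTermOn shiftSetFlat 0 (mirrorTable ε ε) Φ
        (fun j k s => quadTermOn shiftSetFlat 0 (mirrorTable ε ε) Φ j k s) i n x) (uIcc τ (τ + h)) x :=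
    fun x _ => ((hQd x).const_mul _).hasDerivWithinAt
  have hmv := Convex.norm_image_sub_le_of_norm_hasDerivWithin_le hd hb (convex_uIcc τ (τ + h)) left_mem_uIcc
    right_mem_uIcc
  rw [Real.norm_eq_abs, Real.norm_eq_abs, ← mul_sub, abs_mul, abs_of_pos hw0, add_sub_cancel_left] at hmv
  exact hmv

/-- **LANDING AT THE SECTION TIME `τ − h`.** See the module docstring.
[cite: Tao2016AveragedNS, §4 (4.8), §6.3–6.4 (statement shape: re-centring at a checkpoint); route TaoLadderRungTwoFlat, L5a landing ⇒ `HopTube.coreClause_recentre` (LADDER §50.8, §51)] -/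
theorem landing_at_section_time {ε : ℝ} {Φ X : Fin 2 → ℤ → ℝ → ℝ} {g M Mw MX D κ h τ : ℝ} {e : ℤ}
    (hΦ : IsGlobalSol ε Φ) (hX : IsGlobalSol ε X) (hg : 1 ≤ g) (hΦb : ∀ i n t, |Φ i n t| ≤ M)
    (hMw : 0 ≤ Mw) (hΦg : ∀ j k, ∀ t ∈ Icc (τ - 1) (τ + 1), headGauge g j k * |Φ j k t| ≤ Mw)
    (hMX : 0 ≤ MX) (hXg : ∀ j k, ∀ t ∈ Icc (τ - 1) (τ + 1), headGauge g j k * |X j k t| ≤ MX)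
    (hh : |h| ≤ 1) (hD0 : 0 ≤ D)
    (hD : ∀ (j : Fin 2) (m : ℤ), e ≤ m → headGauge g j m * |X j m τ - κ * Φ j m (τ + h)| ≤ D)
    (i : Fin 2) (m : ℤ) (hm : e + 1 ≤ m) :
    headGauge g i m * |X i m (τ - h) - κ * Φ i m τ|
      ≤ D + 2 * (tableAbsSum shiftSetFlat (mirrorTable ε ε)) ^ 2 * g ^ 2 * (MX ^ 3 + 2 * |κ| * Mw ^ 3) * h ^ 2
        + |h| * (|κ| * |1 - κ| * (tableAbsSum shiftSetFlat (mirrorTable ε ε) * g * Mw ^ 2)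
          + 2 * tableAbsSum shiftSetFlat (mirrorTable ε ε) * (|κ| * M) * g * D
          + tableAbsSum shiftSetFlat (mirrorTable ε ε) * g * D ^ 2) := by
  have hwpos : ∀ j k, 0 < headGauge g j k := fun j k => headGauge_pos (by linarith) j k
  have hA : IsWindowAdmissible (headGauge g) g := isWindowAdmissible_headGauge hg
  have hw : IsWindowRegular (headGauge g) g := isWindowRegular_headGauge hg
  have hw0 : 0 < headGauge g i m := hwpos i m
  have hT0 : 0 ≤ tableAbsSum shiftSetFlat (mirrorTable ε ε) := tableAbsSum_nonneg _ _
  have hτh : τ + h ∈ Icc (τ - 1) (τ + 1) := by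
    constructor <;> linarith [(abs_le.mp hh).1, (abs_le.mp hh).2]
  -- abbreviations (opaque, with defining equations)
  obtain ⟨Ψf, hΨf⟩ : ∃ Ψf : Fin 2 → ℤ → ℝ → ℝ, Ψf = fun j k s => κ * Φ j k (s + h) := ⟨_, rfl⟩
  obtain ⟨df, hdf⟩ : ∃ df : Fin 2 → ℤ → ℝ → ℝ, df = fun j k s => X j k s - κ * Φ j k (s + h) := ⟨_, rfl⟩
  have hXsplit : X = Ψf + df := by
    funext j k s; rw [hΨf, hdf]; simp only [Pi.add_apply]; ring
  -- (1) Taylor of X backwards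
  have t1 := gauge_abs_taylor_le isNearestNeighbourSet_shiftSetFlat (mirrorTable ε ε) hwpos hA hMX hX hXg
    (h := -h) (by rwa [abs_neg]) i m
  rw [show τ + -h = τ - h by ring, show (-h) ^ 2 = h ^ 2 by ring] at t1
  -- (2) the landing datum at τ
  have t2 : headGauge g i m * |X i m τ - κ * Φ i m (τ + h)| ≤ D := hD i m (by omega)
  -- (3) Taylor of Φ forwards
  have t3 := gauge_abs_taylor_le isNearestNeighbourSet_shiftSetFlat (mirrorTable ε ε) hwpos hA hMw hΦ hΦg hh i m
  -- (4a) time-Lipschitz of Q(Φ)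
  have t4a := gauge_abs_quadTermOn_sub_time_le hΦ hg hMw hΦg hh i m
  -- (4b) Q(Φ)(τ+h) in the head gauge
  have t4b : headGauge g i m * |quadTermOn shiftSetFlat 0 (mirrorTable ε ε) Φ i m (τ + h)|
      ≤ tableAbsSum shiftSetFlat (mirrorTable ε ε) * g * Mw ^ 2 :=
    gauge_abs_quadTermOn_le isNearestNeighbourSet_shiftSetFlat (mirrorTable ε ε) hwpos hA hMw
      (fun j k _ => hΦg j k (τ + h) hτh)
  -- (4c) the linear response of the deviation d around Ψ
  have hΨb : ∀ j k, |Ψf j k τ| ≤ |κ| * M := by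
    intro j k; rw [hΨf]; simp only [abs_mul]
    exact mul_le_mul_of_nonneg_left (hΦb j k (τ + h)) (abs_nonneg _)
  have hdwin : ∀ j k, m - 1 ≤ k ∧ k ≤ m + 1 → headGauge g j k * |df j k τ| ≤ D := by
    intro j k hk; rw [hdf]; exact hD j k (by omega)
  have t4c : headGauge g i m * |linTermOn shiftSetFlat 0 (mirrorTable ε ε) Ψf df i m τ|
      ≤ 2 * tableAbsSum shiftSetFlat (mirrorTable ε ε) * (|κ| * M) * g * D :=
    gauge_abs_linTermOn_le_of_sup isNearestNeighbourSet_shiftSetFlat (mirrorTable ε ε) hw hΨb hD0 hdwin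
  -- (4d) the quadratic self-term of d
  have t4d : headGauge g i m * |quadTermOn shiftSetFlat 0 (mirrorTable ε ε) df i m τ|
      ≤ tableAbsSum shiftSetFlat (mirrorTable ε ε) * g * D ^ 2 :=
    gauge_abs_quadTermOn_le isNearestNeighbourSet_shiftSetFlat (mirrorTable ε ε) hwpos hA hD0 hdwin
  -- Q(X)(τ) = κ² Q(Φ)(τ+h) + Lin_Ψ(d)(τ) + Q(d)(τ)
  have hQΨ : quadTermOn shiftSetFlat 0 (mirrorTable ε ε) Ψf i m τ
      = κ ^ 2 * quadTermOn shiftSetFlat 0 (mirrorTable ε ε) Φ i m (τ + h) := by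
    have e1 : Ψf = κ • (fun j k s => Φ j k (s + h)) := by
      funext j k s; rw [hΨf]; simp only [Pi.smul_apply, smul_eq_mul]
    rw [e1, quadTermOn_smul, quadTermOn_timeShift]
  have hQX : quadTermOn shiftSetFlat 0 (mirrorTable ε ε) X i m τ
      = κ ^ 2 * quadTermOn shiftSetFlat 0 (mirrorTable ε ε) Φ i m (τ + h)
        + linTermOn shiftSetFlat 0 (mirrorTable ε ε) Ψf df i m τ
        + quadTermOn shiftSetFlat 0 (mirrorTable ε ε) df i m τ := by
    rw [hXsplit, quadTermOn_add_eq_lin, hQΨ]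
  -- the algebraic decomposition at site (i, m)
  have hdecomp : X i m (τ - h) - κ * Φ i m τ
      = (X i m (τ - h) - X i m τ - (-h) * quadTermOn shiftSetFlat 0 (mirrorTable ε ε) X i m τ)
        + (X i m τ - κ * Φ i m (τ + h))
        + κ * (Φ i m (τ + h) - Φ i m τ - h * quadTermOn shiftSetFlat 0 (mirrorTable ε ε) Φ i m τ)
        + h * (κ * (quadTermOn shiftSetFlat 0 (mirrorTable ε ε) Φ i m τ
                - quadTermOn shiftSetFlat 0 (mirrorTable ε ε) Φ i m (τ + h))
              + κ * (1 - κ) * quadTermOn shiftSetFlat 0 (mirrorTable ε ε) Φ i m (τ + h)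
              - linTermOn shiftSetFlat 0 (mirrorTable ε ε) Ψf df i m τ
              - quadTermOn shiftSetFlat 0 (mirrorTable ε ε) df i m τ) := by
    rw [hQX]; ring
  -- triangle inequality in the head gauge
  have habs : |X i m (τ - h) - κ * Φ i m τ|
      ≤ |X i m (τ - h) - X i m τ - (-h) * quadTermOn shiftSetFlat 0 (mirrorTable ε ε) X i m τ|
        + |X i m τ - κ * Φ i m (τ + h)|
        + |κ| * |Φ i m (τ + h) - Φ i m τ - h * quadTermOn shiftSetFlat 0 (mirrorTable ε ε) Φ i m τ|
        + |h| * (|κ| * |quadTermOn shiftSetFlat 0 (mirrorTable ε ε) Φ i m τ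
                - quadTermOn shiftSetFlat 0 (mirrorTable ε ε) Φ i m (τ + h)|
              + |κ| * |1 - κ| * |quadTermOn shiftSetFlat 0 (mirrorTable ε ε) Φ i m (τ + h)|
              + |linTermOn shiftSetFlat 0 (mirrorTable ε ε) Ψf df i m τ|
              + |quadTermOn shiftSetFlat 0 (mirrorTable ε ε) df i m τ|) := by
    rw [hdecomp]
    refine (abs_add_le _ _).trans ?_
    refine add_le_add ((abs_add_le _ _).trans (add_le_add ((abs_add_le _ _).trans le_rfl) ?_)) ?_
    · rw [abs_mul]
    · rw [abs_mul]
      refine mul_le_mul_of_nonneg_left ?_ (abs_nonneg _)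
      refine (abs_sub _ _).trans (add_le_add ((abs_sub _ _).trans (add_le_add ((abs_add_le _ _).trans
        (add_le_add (by rw [abs_mul]) (by rw [abs_mul, abs_mul]))) le_rfl)) le_rfl)
  -- the time-Lipschitz term read with the arguments swapped
  have t4a' : headGauge g i m * |quadTermOn shiftSetFlat 0 (mirrorTable ε ε) Φ i m τ
        - quadTermOn shiftSetFlat 0 (mirrorTable ε ε) Φ i m (τ + h)|
      ≤ 2 * (tableAbsSum shiftSetFlat (mirrorTable ε ε)) ^ 2 * g ^ 2 * Mw ^ 3 * |h| := by
    rw [abs_sub_comm]; exact t4a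
  -- assemble
  have hκ0 : 0 ≤ |κ| := abs_nonneg _
  have h1κ0 : 0 ≤ |1 - κ| := abs_nonneg _
  have hh0 : 0 ≤ |h| := abs_nonneg _
  have hsq : |h| * |h| = h ^ 2 := by rw [← sq, sq_abs]
  calc headGauge g i m * |X i m (τ - h) - κ * Φ i m τ|
      ≤ headGauge g i m * (|X i m (τ - h) - X i m τ - (-h) * quadTermOn shiftSetFlat 0 (mirrorTable ε ε) X i m τ|
        + |X i m τ - κ * Φ i m (τ + h)|
        + |κ| * |Φ i m (τ + h) - Φ i m τ - h * quadTermOn shiftSetFlat 0 (mirrorTable ε ε) Φ i m τ|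
        + |h| * (|κ| * |quadTermOn shiftSetFlat 0 (mirrorTable ε ε) Φ i m τ
                - quadTermOn shiftSetFlat 0 (mirrorTable ε ε) Φ i m (τ + h)|
              + |κ| * |1 - κ| * |quadTermOn shiftSetFlat 0 (mirrorTable ε ε) Φ i m (τ + h)|
              + |linTermOn shiftSetFlat 0 (mirrorTable ε ε) Ψf df i m τ|
              + |quadTermOn shiftSetFlat 0 (mirrorTable ε ε) df i m τ|)) :=
        mul_le_mul_of_nonneg_left habs hw0.le
    _ = headGauge g i m * |X i m (τ - h) - X i m τ - (-h) * quadTermOn shiftSetFlat 0 (mirrorTable ε ε) X i m τ|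
        + headGauge g i m * |X i m τ - κ * Φ i m (τ + h)|
        + |κ| * (headGauge g i m *
            |Φ i m (τ + h) - Φ i m τ - h * quadTermOn shiftSetFlat 0 (mirrorTable ε ε) Φ i m τ|)
        + |h| * (|κ| * (headGauge g i m * |quadTermOn shiftSetFlat 0 (mirrorTable ε ε) Φ i m τ
                - quadTermOn shiftSetFlat 0 (mirrorTable ε ε) Φ i m (τ + h)|)
              + |κ| * |1 - κ| * (headGauge g i m * |quadTermOn shiftSetFlat 0 (mirrorTable ε ε) Φ i m (τ + h)|)
              + headGauge g i m * |linTermOn shiftSetFlat 0 (mirrorTable ε ε) Ψf df i m τ|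
              + headGauge g i m * |quadTermOn shiftSetFlat 0 (mirrorTable ε ε) df i m τ|) := by ring
    _ ≤ 2 * (tableAbsSum shiftSetFlat (mirrorTable ε ε)) ^ 2 * g ^ 2 * MX ^ 3 * h ^ 2
        + D
        + |κ| * (2 * (tableAbsSum shiftSetFlat (mirrorTable ε ε)) ^ 2 * g ^ 2 * Mw ^ 3 * h ^ 2)
        + |h| * (|κ| * (2 * (tableAbsSum shiftSetFlat (mirrorTable ε ε)) ^ 2 * g ^ 2 * Mw ^ 3 * |h|)
              + |κ| * |1 - κ| * (tableAbsSum shiftSetFlat (mirrorTable ε ε) * g * Mw ^ 2)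
              + 2 * tableAbsSum shiftSetFlat (mirrorTable ε ε) * (|κ| * M) * g * D
              + tableAbsSum shiftSetFlat (mirrorTable ε ε) * g * D ^ 2) := by
        gcongr
    _ = D + 2 * (tableAbsSum shiftSetFlat (mirrorTable ε ε)) ^ 2 * g ^ 2 * (MX ^ 3 + 2 * |κ| * Mw ^ 3) * h ^ 2
        + |h| * (|κ| * |1 - κ| * (tableAbsSum shiftSetFlat (mirrorTable ε ε) * g * Mw ^ 2)
          + 2 * tableAbsSum shiftSetFlat (mirrorTable ε ε) * (|κ| * M) * g * D
          + tableAbsSum shiftSetFlat (mirrorTable ε ε) * g * D ^ 2) := by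
        rw [← hsq]; ring

end MirrorPulse

end Summit.NavierStokesRegularity.NavierStokesRegularity.Theorems

end
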